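import Mathlib
import HarnessLib
import Summits.ResolutionOfSingularities.ResolutionOfSingularities.Theorems.WildQuotientsWildQuotientResolutionJordanFourI6StableJ4
import Summits.ResolutionOfSingularities.ResolutionOfSingularities.Theorems.WildQuotientsWildQuotientResolutionJordanFourChartC
import Summits.ResolutionOfSingularities.ResolutionOfSingularities.Theorems.WildQuotientsWildQuotientResolutionJordanFourI6Divisorial
import Summits.ResolutionOfSingularities.ResolutionOfSingularities.Theorems.WildQuotientsWildQuotientResolutionToricExitJordanThreeBrickNonempty
import Summits.ResolutionOfSingularities.ResolutionOfSingularities.Theorems.WildQuotientsWildQuotientResolutionToricExitJordanThreeBrickRegular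
import Summits.ResolutionOfSingularities.ResolutionOfSingularities.Theorems.WildQuotientsWildQuotientResolutionBlowupChartStalk
import Summits.ResolutionOfSingularities.ResolutionOfSingularities.Theorems.WildQuotientsWildQuotientResolutionBlowupChartRegularPiece
import Summits.ResolutionOfSingularities.ResolutionOfSingularities.Theorems.WildQuotientsWildQuotientResolutionBlowupLocalExit
import Literature.AlgebraicGeometry.Resolution.BlowupPrincipalCharts
import Literature.AlgebraicGeometry.Resolution.BlowupsEquivariant
import Literature.AlgebraicGeometry.Resolution.AffineBlowupAlgebra

/-!
# V4U piece 2: the three bridge bricks of the smooth chart `V[x_c⁶]` of `Bl_{I₆} 𝔸ⁿ`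
(crux stmt-ResolutionOfSingularities-15640 `WildQuotients.WildQuotientResolution`, line `Sketch`;
chain w45c programme V4U, `L/w45c/V4U-DESIGN.md` §4/§5 (piece `O₂ ⊆ D₊(x_c⁶t)`), `CHAIN.md` v6.2;
supply for «hQ piece 2» (stub-4) and for res-L1-w45c-lead-1's `jordanFour_hasResolution_of_bricks`;
written by res-D-pv-033 AS res-L1-w45c-stub-5; [OURS · L1 W4.5c] — NOT a statement of any manuscript.)

`J₄` datum: `σ x_a = x_a`, `σ x_b = x_b + x_a`, `σ x_c = x_c + x_b`, `σ x_d = x_d + x_c`, passengers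
fixed; `I₆` = the generator vector of record
`![x_a², x_a x_b², x_a x_b x_c, x_a x_c³, x_b³, x_b² x_c², x_b x_c⁴, x_c⁶]`; `V = Bl_{I₆} 𝔸ⁿ`
(`affineBlowup`), lifted action `(affineBlowup.isBlowup _).liftAction ρ (JordanFour.idealSheaf_I6_comap …)`,
`V[⊤, x_c⁶] = blowupChart π Ĩ₆ ⊤ x_c⁶` the Literature principal chart. The J₃ bricks of
p497670/p498242/p498967 (`ToricExit.*_centre_b`) transposed to `I₆`, `x_c⁶`:

* `JordanFour.isRegularLocalRing_stalk_of_mem_blowupChart_I6_c` — the points of `V[⊤, x_c⁶]` have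
  regular local rings (stub-2's `JordanFour.isRegularRing_chartRing_I6_c`, p489593, moved along
  `reesChartEquiv`, `BlowupExit.isRegularRing_blowupAlgebra_map_of_ringEquiv` (p498967) and
  `BlowupExit.isRegular_blowupChart_of_isRegularRing` (p492566));
* `JordanFour.nonempty_iInf_preimage_blowupChart_I6_c` — the stable piece `⋂_g g⁻¹ V[⊤, x_c⁶]` is
  non-empty (`V` integral, p490963; generic-point-free engine of p498242);
* `JordanFour.isPrincipal_stalkAug_liftAction_of_mem_blowupChart_I6_c` — at every point of
  `V[⊤, x_c⁶]` fixed by the lift of `g ∈ ⟨σ⟩` (`char k = p ≥ 5`) the stalk augmentation ideal is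
  principal (stub-4's `JordanFour.I6.isPrincipal_stalkAug_liftAction_of_mem`, p493991, with its
  hypothesis `I₆ ⊆ (x_c)⁶ · 𝒪_{V,v}` supplied by stub-3's chart dictionary p489049).
-/

-- single-problem summit: the doubled namespace component `ResolutionOfSingularities` is forced
set_option linter.dupNamespace false

noncomputable section

open CategoryTheory AlgebraicGeometry TopologicalSpace MvPolynomial HomogeneousLocalization
open Literature.AlgebraicGeometry.Resolution

namespace Summit.ResolutionOfSingularities.ResolutionOfSingularities.Theorems.WildQuotientResolution.JordanFour

/-- **The affine blowup algebra of the chart `V[⊤, x_c⁶]` of `Bl_{I₆} 𝔸ⁿ` is a regular ring**: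
`Γ(𝔸ⁿ, ⊤)[Ĩ₆(⊤)/x_c⁶] ≅ k[x][I₆/x_c⁶] ≅ (k[x][I₆t])_{(x_c⁶t)}`, the last ring being regular
(`JordanFour.isRegularRing_chartRing_I6_c`, p489593). [OURS · L1 W4.5c]
[folklore; assembly of landed decls] -/
theorem isRegularRing_blowupAlgebra_idealSheaf_I6_c (k : Type) [Field k] (n : ℕ)
    (a b c : Fin n) (hab : a ≠ b) (hbc : b ≠ c) (hac : a ≠ c) :
    IsRegularRing (blowupAlgebra
      ((affineBlowup.idealSheaf (Ideal.span (Set.range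
        (![X a ^ 2, X a * X b ^ 2, X a * X b * X c, X a * X c ^ 3, X b ^ 3, X b ^ 2 * X c ^ 2,
          X b * X c ^ 4, X c ^ 6] : Fin 8 → MvPolynomial (Fin n) k)))).ideal ⟨⊤, isAffineOpen_top _⟩)
      ((Scheme.ΓSpecIso (CommRingCat.of (MvPolynomial (Fin n) k))).inv.hom (X c ^ 6))) := by
  have hxc : (X c ^ 6 : MvPolynomial (Fin n) k) ∈ Ideal.span (Set.range
      (![X a ^ 2, X a * X b ^ 2, X a * X b * X c, X a * X c ^ 3, X b ^ 3, X b ^ 2 * X c ^ 2,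
        X b * X c ^ 4, X c ^ 6] : Fin 8 → MvPolynomial (Fin n) k)) :=
    Ideal.subset_span ⟨7, rfl⟩
  haveI : IsRegularRing (Away (reesGrading (Ideal.span (Set.range
      (![X a ^ 2, X a * X b ^ 2, X a * X b * X c, X a * X c ^ 3, X b ^ 3, X b ^ 2 * X c ^ 2,
        X b * X c ^ 4, X c ^ 6] : Fin 8 → MvPolynomial (Fin n) k))))
      (reesT (X c ^ 6 : MvPolynomial (Fin n) k) hxc)) :=
    isRegularRing_chartRing_I6_c k n a b c hab hbc hac
  have h1 : IsRegularRing (blowupAlgebra (Ideal.span (Set.range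
      (![X a ^ 2, X a * X b ^ 2, X a * X b * X c, X a * X c ^ 3, X b ^ 3, X b ^ 2 * X c ^ 2,
        X b * X c ^ 4, X c ^ 6] : Fin 8 → MvPolynomial (Fin n) k))) (X c ^ 6 : MvPolynomial (Fin n) k)) :=
    IsRegularRing.of_ringEquiv (R := Away (reesGrading (Ideal.span (Set.range
      (![X a ^ 2, X a * X b ^ 2, X a * X b * X c, X a * X c ^ 3, X b ^ 3, X b ^ 2 * X c ^ 2,
        X b * X c ^ 4, X c ^ 6] : Fin 8 → MvPolynomial (Fin n) k))))
      (reesT (X c ^ 6 : MvPolynomial (Fin n) k) hxc))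
      (reesChartEquiv (X c ^ 6 : MvPolynomial (Fin n) k) hxc)
  have h2 := BlowupExit.isRegularRing_blowupAlgebra_map_of_ringEquiv
    (Scheme.ΓSpecIso (CommRingCat.of (MvPolynomial (Fin n) k))).commRingCatIsoToRingEquiv.symm
    (Scheme.ΓSpecIso (CommRingCat.of (MvPolynomial (Fin n) k))).inv.hom (fun _ => rfl)
    (Ideal.span (Set.range
      (![X a ^ 2, X a * X b ^ 2, X a * X b * X c, X a * X c ^ 3, X b ^ 3, X b ^ 2 * X c ^ 2,
        X b * X c ^ 4, X c ^ 6] : Fin 8 → MvPolynomial (Fin n) k))) (X c ^ 6) h1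
  have hIdeal : (affineBlowup.idealSheaf (Ideal.span (Set.range
      (![X a ^ 2, X a * X b ^ 2, X a * X b * X c, X a * X c ^ 3, X b ^ 3, X b ^ 2 * X c ^ 2,
        X b * X c ^ 4, X c ^ 6] : Fin 8 → MvPolynomial (Fin n) k)))).ideal ⟨⊤, isAffineOpen_top _⟩ =
      (Ideal.span (Set.range
        (![X a ^ 2, X a * X b ^ 2, X a * X b * X c, X a * X c ^ 3, X b ^ 3, X b ^ 2 * X c ^ 2,
          X b * X c ^ 4, X c ^ 6] : Fin 8 → MvPolynomial (Fin n) k))).map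
        (Scheme.ΓSpecIso (CommRingCat.of (MvPolynomial (Fin n) k))).inv.hom := by
    change (Scheme.IdealSheafData.ofIdealTop _).ideal ⟨⊤, isAffineOpen_top _⟩ = _
    rw [ideal_ofIdealTop_top]
  rw [hIdeal]
  exact h2

/-- **Brick `Hreg₂` of the J₄ toric exit, piece 2**: every point of the principal chart `V[⊤, x_c⁶]`
of `V = Bl_{I₆} 𝔸ⁿ` has a regular local ring. [OURS · L1 W4.5c] [folklore; assembly of landed decls] -/
theorem isRegularLocalRing_stalk_of_mem_blowupChart_I6_c (k : Type) [Field k] (n : ℕ)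
    (a b c : Fin n) (hab : a ≠ b) (hbc : b ≠ c) (hac : a ≠ c)
    (v : affineBlowup (Ideal.span (Set.range
      (![X a ^ 2, X a * X b ^ 2, X a * X b * X c, X a * X c ^ 3, X b ^ 3, X b ^ 2 * X c ^ 2,
        X b * X c ^ 4, X c ^ 6] : Fin 8 → MvPolynomial (Fin n) k))))
    (hv : v ∈ blowupChart
      (affineBlowup.π (Ideal.span (Set.range
        (![X a ^ 2, X a * X b ^ 2, X a * X b * X c, X a * X c ^ 3, X b ^ 3, X b ^ 2 * X c ^ 2,
          X b * X c ^ 4, X c ^ 6] : Fin 8 → MvPolynomial (Fin n) k))))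
      (affineBlowup.idealSheaf (Ideal.span (Set.range
        (![X a ^ 2, X a * X b ^ 2, X a * X b * X c, X a * X c ^ 3, X b ^ 3, X b ^ 2 * X c ^ 2,
          X b * X c ^ 4, X c ^ 6] : Fin 8 → MvPolynomial (Fin n) k))))
      ⟨⊤, isAffineOpen_top _⟩
      ((Scheme.ΓSpecIso (CommRingCat.of (MvPolynomial (Fin n) k))).inv.hom (X c ^ 6))) :
    IsRegularLocalRing ((affineBlowup (Ideal.span (Set.range
      (![X a ^ 2, X a * X b ^ 2, X a * X b * X c, X a * X c ^ 3, X b ^ 3, X b ^ 2 * X c ^ 2,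
        X b * X c ^ 4, X c ^ 6] : Fin 8 → MvPolynomial (Fin n) k)))).presheaf.stalk v) := by
  have hIdeal : (affineBlowup.idealSheaf (Ideal.span (Set.range
      (![X a ^ 2, X a * X b ^ 2, X a * X b * X c, X a * X c ^ 3, X b ^ 3, X b ^ 2 * X c ^ 2,
        X b * X c ^ 4, X c ^ 6] : Fin 8 → MvPolynomial (Fin n) k)))).ideal ⟨⊤, isAffineOpen_top _⟩ =
      (Ideal.span (Set.range
        (![X a ^ 2, X a * X b ^ 2, X a * X b * X c, X a * X c ^ 3, X b ^ 3, X b ^ 2 * X c ^ 2,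
          X b * X c ^ 4, X c ^ 6] : Fin 8 → MvPolynomial (Fin n) k))).map
        (Scheme.ΓSpecIso (CommRingCat.of (MvPolynomial (Fin n) k))).inv.hom := by
    change (Scheme.IdealSheafData.ofIdealTop _).ideal ⟨⊤, isAffineOpen_top _⟩ = _
    rw [ideal_ofIdealTop_top]
  have hxc : (Scheme.ΓSpecIso (CommRingCat.of (MvPolynomial (Fin n) k))).inv.hom (X c ^ 6) ∈
      (affineBlowup.idealSheaf (Ideal.span (Set.range
        (![X a ^ 2, X a * X b ^ 2, X a * X b * X c, X a * X c ^ 3, X b ^ 3, X b ^ 2 * X c ^ 2,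
          X b * X c ^ 4, X c ^ 6] : Fin 8 → MvPolynomial (Fin n) k)))).ideal
        ⟨⊤, isAffineOpen_top _⟩ := by
    rw [hIdeal]
    exact Ideal.mem_map_of_mem _ (Ideal.subset_span ⟨7, rfl⟩)
  exact BlowupExit.isRegularLocalRing_stalk_of_mem _
    (BlowupExit.isRegular_blowupChart_of_isRegularRing (affineBlowup.isBlowup _)
      ⟨⊤, isAffineOpen_top _⟩ hxc (isRegularRing_blowupAlgebra_idealSheaf_I6_c k n a b c hab hbc hac))
    v hv

/-- **Brick `HneO₂` of the J₄ toric exit, piece 2**: for `V = Bl_{I₆} 𝔸ⁿ` with the lifted action of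
the finite group `⟨σ⟩`, the stable piece `⋂_g g⁻¹ V[⊤, x_c⁶]` is non-empty (`V` integral, p490963;
`V[⊤, x_c⁶] ⊇ D₊(x_c⁶ t) ≠ ∅`). [OURS · L1 W4.5c] [folklore; assembly of landed decls] -/
theorem nonempty_iInf_preimage_blowupChart_I6_c (k : Type) [Field k] (n : ℕ)
    (σ : MvPolynomial (Fin n) k ≃ₐ[k] MvPolynomial (Fin n) k) [Finite ↥(Subgroup.zpowers σ)]
    (a b c : Fin n)
    (ha : σ (X a) = X a) (hb : σ (X b) = X b + X a) (hc : σ (X c) = X c + X b)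
    (ρ : ↥(Subgroup.zpowers σ) →* Aut (Spec (CommRingCat.of (MvPolynomial (Fin n) k))))
    (hρ : ∀ g : ↥(Subgroup.zpowers σ), (ρ g).hom = Spec.map (CommRingCat.ofHom
      ((MulSemiringAction.toRingEquiv (↥(Subgroup.zpowers σ)) (MvPolynomial (Fin n) k) g⁻¹ :
        MvPolynomial (Fin n) k ≃+* MvPolynomial (Fin n) k) :
          MvPolynomial (Fin n) k →+* MvPolynomial (Fin n) k))) :
    (((⨅ g : ↥(Subgroup.zpowers σ),
        (((affineBlowup.isBlowup (Ideal.span (Set.range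
          (![X a ^ 2, X a * X b ^ 2, X a * X b * X c, X a * X c ^ 3, X b ^ 3, X b ^ 2 * X c ^ 2,
            X b * X c ^ 4, X c ^ 6] : Fin 8 → MvPolynomial (Fin n) k)))).liftAction ρ
          (idealSheaf_I6_comap k n σ a b c ha hb hc ρ hρ)) g).hom ⁻¹ᵁ
        blowupChart
          (affineBlowup.π (Ideal.span (Set.range
            (![X a ^ 2, X a * X b ^ 2, X a * X b * X c, X a * X c ^ 3, X b ^ 3, X b ^ 2 * X c ^ 2,
              X b * X c ^ 4, X c ^ 6] : Fin 8 → MvPolynomial (Fin n) k))))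
          (affineBlowup.idealSheaf (Ideal.span (Set.range
            (![X a ^ 2, X a * X b ^ 2, X a * X b * X c, X a * X c ^ 3, X b ^ 3, X b ^ 2 * X c ^ 2,
              X b * X c ^ 4, X c ^ 6] : Fin 8 → MvPolynomial (Fin n) k))))
          ⟨⊤, isAffineOpen_top _⟩
          ((Scheme.ΓSpecIso (CommRingCat.of (MvPolynomial (Fin n) k))).inv.hom (X c ^ 6)) :
        (affineBlowup (Ideal.span (Set.range
          (![X a ^ 2, X a * X b ^ 2, X a * X b * X c, X a * X c ^ 3, X b ^ 3, X b ^ 2 * X c ^ 2,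
            X b * X c ^ 4, X c ^ 6] : Fin 8 → MvPolynomial (Fin n) k)))).Opens)) :
      Set (affineBlowup (Ideal.span (Set.range
        (![X a ^ 2, X a * X b ^ 2, X a * X b * X c, X a * X c ^ 3, X b ^ 3, X b ^ 2 * X c ^ 2,
          X b * X c ^ 4, X c ^ 6] : Fin 8 → MvPolynomial (Fin n) k))))).Nonempty := by
  haveI : IsIntegral (affineBlowup (Ideal.span (Set.range
      (![X a ^ 2, X a * X b ^ 2, X a * X b * X c, X a * X c ^ 3, X b ^ 3, X b ^ 2 * X c ^ 2,
        X b * X c ^ 4, X c ^ 6] : Fin 8 → MvPolynomial (Fin n) k)))) :=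
    (I6_blowup_integral_proper_birational k n a b c).1
  have hxc : (X c ^ 6 : MvPolynomial (Fin n) k) ∈ Ideal.span (Set.range
      (![X a ^ 2, X a * X b ^ 2, X a * X b * X c, X a * X c ^ 3, X b ^ 3, X b ^ 2 * X c ^ 2,
        X b * X c ^ 4, X c ^ 6] : Fin 8 → MvPolynomial (Fin n) k)) :=
    Ideal.subset_span ⟨7, rfl⟩
  haveI := BlowupExit.nontrivial_away_reesT_of_ne_zero (X c ^ 6 : MvPolynomial (Fin n) k) hxc
    (pow_ne_zero 6 (X_ne_zero c))
  refine BlowupExit.nonempty_iInf_preimage_of_irreducibleSpace _ (fun g => ?_) _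
    (BlowupExit.affineBlowup_blowupChart_nonempty (X c ^ 6 : MvPolynomial (Fin n) k) hxc)
  intro v
  refine ⟨(((affineBlowup.isBlowup (Ideal.span (Set.range
      (![X a ^ 2, X a * X b ^ 2, X a * X b * X c, X a * X c ^ 3, X b ^ 3, X b ^ 2 * X c ^ 2,
        X b * X c ^ 4, X c ^ 6] : Fin 8 → MvPolynomial (Fin n) k)))).liftAction ρ
      (idealSheaf_I6_comap k n σ a b c ha hb hc ρ hρ)) g).inv.base v, ?_⟩
  rw [← Scheme.Hom.comp_apply, Iso.inv_hom_id]
  rfl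

/-- **Brick `Hdiv₂` of the J₄ toric exit, piece 2** (`char k = p ≥ 5`): for `V = Bl_{I₆} 𝔸ⁿ` with
the lifted action of `⟨σ⟩`, at every point `v` of the principal chart `V[⊤, x_c⁶]` fixed by the lift
of `g`, the stalk augmentation ideal of `g` is principal (stub-4's p493991, whose hypothesis
`I₆ ⊆ (x_c)⁶ · 𝒪_{V,v}` holds on `V[⊤, x_c⁶]` by p489049). [OURS · L1 W4.5c]
[folklore; assembly of landed decls] -/
theorem isPrincipal_stalkAug_liftAction_of_mem_blowupChart_I6_c (p : ℕ) (hp : p.Prime)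
    (hp5 : 5 ≤ p) (k : Type) [Field k] [CharP k p] (n : ℕ)
    (σ : MvPolynomial (Fin n) k ≃ₐ[k] MvPolynomial (Fin n) k)
    (a b c d : Fin n) (hab : a ≠ b) (hac : a ≠ c) (had : a ≠ d)
    (hb : σ (X b) = X b + X a) (hc : σ (X c) = X c + X b) (hd : σ (X d) = X d + X c)
    (hσ : ∀ i, i ≠ b → i ≠ c → i ≠ d → σ (X i) = X i)
    (ρ : ↥(Subgroup.zpowers σ) →* Aut (Spec (CommRingCat.of (MvPolynomial (Fin n) k))))
    (hρ : ∀ g : ↥(Subgroup.zpowers σ), (ρ g).hom = Spec.map (CommRingCat.ofHom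
      ((MulSemiringAction.toRingEquiv (↥(Subgroup.zpowers σ)) (MvPolynomial (Fin n) k) g⁻¹ :
        MvPolynomial (Fin n) k ≃+* MvPolynomial (Fin n) k) :
          MvPolynomial (Fin n) k →+* MvPolynomial (Fin n) k)))
    (g : ↥(Subgroup.zpowers σ))
    (v : affineBlowup (Ideal.span (Set.range
      (![X a ^ 2, X a * X b ^ 2, X a * X b * X c, X a * X c ^ 3, X b ^ 3, X b ^ 2 * X c ^ 2,
        X b * X c ^ 4, X c ^ 6] : Fin 8 → MvPolynomial (Fin n) k))))
    (hv : (((affineBlowup.isBlowup (Ideal.span (Set.range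
        (![X a ^ 2, X a * X b ^ 2, X a * X b * X c, X a * X c ^ 3, X b ^ 3, X b ^ 2 * X c ^ 2,
          X b * X c ^ 4, X c ^ 6] : Fin 8 → MvPolynomial (Fin n) k)))).liftAction ρ
        (idealSheaf_I6_comap k n σ a b c (hσ a hab hac had) hb hc ρ hρ)) g).hom.base v = v)
    (hvC : v ∈ blowupChart
      (affineBlowup.π (Ideal.span (Set.range
        (![X a ^ 2, X a * X b ^ 2, X a * X b * X c, X a * X c ^ 3, X b ^ 3, X b ^ 2 * X c ^ 2,
          X b * X c ^ 4, X c ^ 6] : Fin 8 → MvPolynomial (Fin n) k))))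
      (affineBlowup.idealSheaf (Ideal.span (Set.range
        (![X a ^ 2, X a * X b ^ 2, X a * X b * X c, X a * X c ^ 3, X b ^ 3, X b ^ 2 * X c ^ 2,
          X b * X c ^ 4, X c ^ 6] : Fin 8 → MvPolynomial (Fin n) k))))
      ⟨⊤, isAffineOpen_top _⟩
      ((Scheme.ΓSpecIso (CommRingCat.of (MvPolynomial (Fin n) k))).inv.hom (X c ^ 6))) :
    (Ideal.span (Set.range fun s =>
      ((affineBlowup (Ideal.span (Set.range
        (![X a ^ 2, X a * X b ^ 2, X a * X b * X c, X a * X c ^ 3, X b ^ 3, X b ^ 2 * X c ^ 2,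
          X b * X c ^ 4, X c ^ 6] : Fin 8 → MvPolynomial (Fin n) k)))).presheaf.stalkSpecializes
          (specializes_of_eq hv) ≫
        (((affineBlowup.isBlowup (Ideal.span (Set.range
          (![X a ^ 2, X a * X b ^ 2, X a * X b * X c, X a * X c ^ 3, X b ^ 3, X b ^ 2 * X c ^ 2,
            X b * X c ^ 4, X c ^ 6] : Fin 8 → MvPolynomial (Fin n) k)))).liftAction ρ
          (idealSheaf_I6_comap k n σ a b c (hσ a hab hac had) hb hc ρ hρ)) g).hom.stalkMap v).hom
            s - s)).IsPrincipal := by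
  haveI : IsIntegral (affineBlowup (Ideal.span (Set.range
      (![X a ^ 2, X a * X b ^ 2, X a * X b * X c, X a * X c ^ 3, X b ^ 3, X b ^ 2 * X c ^ 2,
        X b * X c ^ 4, X c ^ 6] : Fin 8 → MvPolynomial (Fin n) k)))) :=
    (I6_blowup_integral_proper_birational k n a b c).1
  -- the chart dictionary: on `V[⊤, x_c⁶]`, `I₆ ⊆ (x_c⁶) · 𝒪_{V,v}`
  have hmem : ∀ l : Fin 8, ((affineBlowup.π (Ideal.span (Set.range
      (![X a ^ 2, X a * X b ^ 2, X a * X b * X c, X a * X c ^ 3, X b ^ 3, X b ^ 2 * X c ^ 2,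
        X b * X c ^ 4, X c ^ 6] : Fin 8 → MvPolynomial (Fin n) k)))).stalkMap v).hom
        (((Scheme.ΓSpecIso (CommRingCat.of (MvPolynomial (Fin n) k))).inv ≫
          (Spec (CommRingCat.of (MvPolynomial (Fin n) k))).presheaf.germ ⊤
            ((affineBlowup.π (Ideal.span (Set.range
              (![X a ^ 2, X a * X b ^ 2, X a * X b * X c, X a * X c ^ 3, X b ^ 3, X b ^ 2 * X c ^ 2,
                X b * X c ^ 4, X c ^ 6] : Fin 8 → MvPolynomial (Fin n) k)))).base v) trivial).hom
            ((![X a ^ 2, X a * X b ^ 2, X a * X b * X c, X a * X c ^ 3, X b ^ 3, X b ^ 2 * X c ^ 2,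
              X b * X c ^ 4, X c ^ 6] : Fin 8 → MvPolynomial (Fin n) k) l)) ∈
      Ideal.span {((affineBlowup.π (Ideal.span (Set.range
      (![X a ^ 2, X a * X b ^ 2, X a * X b * X c, X a * X c ^ 3, X b ^ 3, X b ^ 2 * X c ^ 2,
        X b * X c ^ 4, X c ^ 6] : Fin 8 → MvPolynomial (Fin n) k)))).stalkMap v).hom
        (((Scheme.ΓSpecIso (CommRingCat.of (MvPolynomial (Fin n) k))).inv ≫
          (Spec (CommRingCat.of (MvPolynomial (Fin n) k))).presheaf.germ ⊤
            ((affineBlowup.π (Ideal.span (Set.range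
              (![X a ^ 2, X a * X b ^ 2, X a * X b * X c, X a * X c ^ 3, X b ^ 3, X b ^ 2 * X c ^ 2,
                X b * X c ^ 4, X c ^ 6] : Fin 8 → MvPolynomial (Fin n) k)))).base v) trivial).hom
            (X c)) ^ 6} := by
    intro l
    have hl : ((![X a ^ 2, X a * X b ^ 2, X a * X b * X c, X a * X c ^ 3, X b ^ 3, X b ^ 2 * X c ^ 2,
        X b * X c ^ 4, X c ^ 6] : Fin 8 → MvPolynomial (Fin n) k) l) ∈ Ideal.span (Set.range
        (![X a ^ 2, X a * X b ^ 2, X a * X b * X c, X a * X c ^ 3, X b ^ 3, X b ^ 2 * X c ^ 2,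
          X b * X c ^ 4, X c ^ 6] : Fin 8 → MvPolynomial (Fin n) k)) :=
      Ideal.subset_span ⟨l, rfl⟩
    have h := BlowupExit.map_germ_mem_span_of_mem_blowupChart_spec
      (affineBlowup.π (Ideal.span (Set.range
        (![X a ^ 2, X a * X b ^ 2, X a * X b * X c, X a * X c ^ 3, X b ^ 3, X b ^ 2 * X c ^ 2,
          X b * X c ^ 4, X c ^ 6] : Fin 8 → MvPolynomial (Fin n) k))))
      (Ideal.span (Set.range
        (![X a ^ 2, X a * X b ^ 2, X a * X b * X c, X a * X c ^ 3, X b ^ 3, X b ^ 2 * X c ^ 2,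
          X b * X c ^ 4, X c ^ 6] : Fin 8 → MvPolynomial (Fin n) k))) hl hvC
    rw [map_pow, map_pow] at h
    exact h
  exact I6.isPrincipal_stalkAug_liftAction_of_mem p hp hp5 k n σ a b c d hab hac had hb hc hd hσ
    _ rfl ρ hρ (affineBlowup.isBlowup _)
    (idealSheaf_I6_comap k n σ a b c (hσ a hab hac had) hb hc ρ hρ) g v hv hmem

end Summit.ResolutionOfSingularities.ResolutionOfSingularities.Theorems.WildQuotientResolution.JordanFour

end
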